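import Summits.Ventures.PercRepro.S1ChainPairs
import Summits.Ventures.PercRepro.S1ChainPairsMin
import Summits.Ventures.PercRepro.S1ChainFamily
import Summits.Ventures.PercRepro.S1ChainCells
import Summits.Ventures.PercRepro.S1ChainKillAbs

/-!
# PercRepro — A CELL BY THE CHAIN LEVERS WITH THE PER-PAIR KILL (p2, gen 23; SUBCLAIM-S1 §6.8 (v))

The consumer of S1ChainPairs: the chain family `𝒯′` of `exists_chain_family` with union `S` (`u = |S|`) is killed
with the per-pair overlaps — `C(n − 6, p − 6)` per pair and `C(n − 5, p − 5) − C(n − 6, p − 6)` for at most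
`δ(δ + 1)/2` pairs, `δ = 3|𝒯′| − u` — and the exclusion at `k = d + 1 − r` is taken as in S1ChainCells. Lines (A)
`u ∈ [3, 3r]` with `|𝒯′| = r`; lines (B) `i ∈ [1, r − 1]`, `u ∈ [3, 3i]` with `|𝒯′| = i` and no outside triangle.

* `killPairB` — the overlap term of the kernel line;
* `cellYsum_kill_le_pairs`, `weighted_of_killnullOK_pairs` — the consumers of the per-pair kill;
* **`rls_of_ladder_case_chain_pairs`** — one ladder case from the per-pair chain lines.
Axioms: standard.
-/

open scoped Matroid

namespace PercRepro

namespace S1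

open Set

variable {α : Type}

/-- The overlap term of a per-pair chain line:
`C(r, 2)·C(n − 6, p − 6) + min (C(r, 2)) (δ(δ + 1)/2)·(C(n − 5, p − 5) − C(n − 6, p − 6))` with `δ = 3r − u`. -/
def killPairB (r u n p : ℕ) : ℕ :=
  r.choose 2 * (n - 6).choose (p - 6) +
    min (r.choose 2) ((3 * r - u) * (3 * r - u + 1) / 2) * ((n - 5).choose (p - 5) - (n - 6).choose (p - 6))

/-- `cellYsum_kill_le` with the per-pair overlaps of a triangle family with union `u` (S1ChainPairs). -/
theorem cellYsum_kill_le_pairs (M : Matroid α) [M.Finite] (p d P S S5 : ℕ) (hd4 : 4 ≤ d) (hR : M.eRank = (p : ℕ∞))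
    (hn : M.E.ncard = p + d)
    (hfree : ∀ e ∈ M.E, ∃ A ⊆ M.E \ {e}, e ∉ M.closure A ∧ e ∉ M.closure ((M.E \ {e}) \ A))
    (hP : {C : Set α | M.IsCircuit C ∧ C.ncard = 3}.ncard ≤ P) (hS : {C : Set α | M.IsCircuit C ∧ C.ncard = 4}.ncard ≤ S)
    (hS5 : {C : Set α | M.IsCircuit C ∧ C.ncard = 5}.ncard ≤ S5)
    (hp : 6 ≤ p) (𝒯 : Finset (Set α)) (h𝒯 : ∀ C ∈ 𝒯, M.IsCircuit C ∧ C.ncard = 3) {u : ℕ}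
    (hu : (⋃ T ∈ 𝒯, T).ncard = u) :
    cellYsum p d + 7560 * (𝒯.card * (p + d - 3).choose (p - 3)) ≤
      7560 * Matroid.midCount M p 4 + cellR34 p d P S S5 + 7560 * killPairB 𝒯.card u (p + d) p := by
  have hL : ∀ e ∈ M.E, ¬ M.IsLoop e := ThmN.not_isLoop_of_free M hfree
  have hs : ∀ e ∈ M.E, ∀ f ∈ M.E, e ≠ f → M.eRk {e, f} = 2 := by
    intro e he f hf hef
    have h2 : (2 : ℕ∞) ≤ M.eRk {e, f} :=
      ThmN.two_le_eRk_of_two_le_ncard_of_free M hfree (pair_subset he hf) (by rw [ncard_pair hef])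
    have h3 : M.eRk {e, f} ≤ 2 := by
      have := M.eRk_le_encard {e, f}
      rwa [encard_pair hef] at this
    exact le_antisymm h3 h2
  have hcirc : ∀ C, M.IsCircuit C → 3 ≤ C.encard := ThmN.three_le_encard_of_circuit M hL hs
  have hline : ∀ L ⊆ M.E, M.eRk L ≤ 2 → L.ncard ≤ 3 := by
    intro L hL' hr
    have := ThmN.ncard_add_one_le_two_pow_of_eRk_le M hL hfree 2 L hL' hr
    omega
  have hplane : ∀ P ⊆ M.E, M.eRk P ≤ 3 → P.ncard ≤ 6 := fun P hP hr =>
    ThmN.ncard_le_six_of_eRk_le_three_of_free M hfree hP hr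
  have hten : ∀ X ⊆ M.E, M.eRk X ≤ 4 → X.ncard ≤ 10 := fun X hX hr =>
    ThmN.ncard_le_ten_of_eRk_le_four_of_free M hfree hX hr
  have hd : M.E.encard = M.eRank + d := by
    rw [hR, ← M.ground_finite.cast_ncard_eq, hn]
    push_cast
    ring
  have hY := midCount_ge_K7_kill_pairs' M hcirc hline hplane hten hd p hp (by omega) 𝒯 h𝒯 hu
  have h := cellYsum_kill_le_abs M p d P S S5 hd4 hR hn hfree hP hS hS5 _ _ hY
  unfold killPairB
  rw [hn] at h
  exact h

/-- `weighted_of_killnullOK` with the per-pair kill of a triangle family with union `u`. -/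
theorem weighted_of_killnullOK_pairs (N : Matroid α) [N.Finite] (p0 p d P S S5 A B X : ℕ) (hd4 : 4 ≤ d)
    (hR : N.eRank = (p : ℕ∞)) (hn : N.E.ncard = p + d)
    (hfree : ∀ e ∈ N.E, ∃ Z ⊆ N.E \ {e}, e ∉ N.closure Z ∧ e ∉ N.closure ((N.E \ {e}) \ Z))
    (hP : {C : Set α | N.IsCircuit C ∧ C.ncard = 3}.ncard ≤ P) (hS : {C : Set α | N.IsCircuit C ∧ C.ncard = 4}.ncard ≤ S)
    (hS5 : {C : Set α | N.IsCircuit C ∧ C.ncard = 5}.ncard ≤ S5)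
    (hp : 6 ≤ p) (hp0 : 5 ≤ p0) (𝒯 : Finset (Set α))
    (h𝒯 : ∀ C ∈ 𝒯, N.IsCircuit C ∧ C.ncard = 3) {u : ℕ} (hu : (⋃ T ∈ 𝒯, T).ncard = u)
    {Sn : Set α} (hSn : Sn ⊆ N.E) {r kk : ℕ} (hν : N.eRk Sn + (r : ℕ∞) ≤ (Sn.ncard : ℕ∞)) (hkk : d + 1 ≤ kk + r)
    (hX : X ≤ {B : Set α | B ⊆ N.E ∧ B.ncard = 4 ∧ N.eRk B = 4 ∧ kk ≤ (B \ Sn).ncard}.ncard)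
    (hok : killnullOK p0 p d P S S5 (A + 𝒯.card * (p + d - 3).choose (p - 3))
      (B + killPairB 𝒯.card u (p + d) p) X = true) :
    phiK p0 4 * (Matroid.topCount N p 4 : ℚ) + B ≤ (Matroid.midCount N p 4 : ℚ) + A :=
  weighted_of_killnullOK_abs N p0 p d P S S5 A B X hd4 hR hn hfree hP hS hS5 (by omega) hp0 _ _
    (cellYsum_kill_le_pairs N p d P S S5 hd4 hR hn hfree hP hS hS5 hp 𝒯 h𝒯 hu) hSn hν hkk hX hok

/-- **ONE LADDER CASE BY THE CHAIN LEVERS WITH THE PER-PAIR KILL**: as `rls_of_ladder_case_chain`, the kill of the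
chain family with the per-pair overlaps (`killPairB`): (A) for every `u ∈ [3, 3r]` the chain of `r` triangles with
union `u` and `t − r` outside; (B) for every `i ∈ [1, r − 1]` and `u ∈ [3, 3i]` the stopped chain of `i` triangles
with union `u` and no outside triangle. -/
theorem rls_of_ladder_case_chain_pairs (M : Matroid α) [M.Finite] {p0 p c d n : ℕ} (hp0 : p0 = p + c) (hnd : n = p0 + d)
    (hR : M.eRank = (p0 : ℕ∞)) (hn : M.E.ncard = n)
    (hfree : ∀ e ∈ M.E, ∃ A ⊆ M.E \ {e}, e ∉ M.closure A ∧ e ∉ M.closure ((M.E \ {e}) \ A))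
    (hc : M.coloops.ncard = c) (hp : 6 ≤ p) (hd4 : 4 ≤ d) {P S S5 : ℕ}
    (hP : min ((p + d) * TriangleCap.cq3 (d - 1) / (p + d - 3)) (TriangleCap.cq3 d) ≤ P)
    (hScap : ∀ (N : Matroid α) [N.Finite],
      (∀ e ∈ N.E, ∃ A ⊆ N.E \ {e}, e ∉ N.closure A ∧ e ∉ N.closure ((N.E \ {e}) \ A)) →
      N.E.encard = N.eRank + ((d : ℕ) : ℕ∞) → N.E.ncard = p + d → N.coloops = ∅ →
      {C : Set α | N.IsCircuit C ∧ C.ncard = 4}.ncard ≤ S)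
    (hS5 : (p + d) * avgChain5b (d - 1) / (p + d - 5) ≤ S5)
    (rr : ℕ → ℕ)
    (hrr : ∀ t ∈ Finset.Icc 1 P, 1 ≤ rr t ∧ TriangleCap.cq3 (rr t - 1) < t ∧
      ∀ ν < rr t, TriangleCap.cq3 ν ≤ TriangleCap.cq3 (rr t - 1))
    (hzero : ladderOK p0 p d 0 S S5 (∑ j ∈ Finset.range c, 2 ^ (n - 1 - j))
      (∑ j ∈ Finset.range c, w3plus (n - 1 - j)) = true)
    (hokA : ∀ t ∈ Finset.Icc 1 P, ∀ u ∈ Finset.Icc 3 (3 * rr t),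
      killnullOK p0 p d t S S5 ((∑ j ∈ Finset.range c, 2 ^ (n - 1 - j)) + rr t * (p + d - 3).choose (p - 3))
        ((∑ j ∈ Finset.range c, w3plus (n - 1 - j)) + killPairB (rr t) u (p + d) p)
        (exclXc (p + d) (p + d - u) (d + 1 - rr t) S t (rr t)) = true)
    (hokB : ∀ t ∈ Finset.Icc 1 P, ∀ i ∈ Finset.Icc 1 (rr t - 1), ∀ u ∈ Finset.Icc 3 (3 * i),
      killnullOK p0 p d t S S5 ((∑ j ∈ Finset.range c, 2 ^ (n - 1 - j)) + i * (p + d - 3).choose (p - 3))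
        ((∑ j ∈ Finset.range c, w3plus (n - 1 - j)) + killPairB i u (p + d) p)
        (exclXc (p + d) (p + d - u) (d + 1 - rr t) S t t) = true) :
    ThmN.RLS M p0 4 := by
  subst hp0
  have hR' : M.eRank = ((p + c : ℕ) : ℕ∞) := hR
  obtain ⟨N, hNfin, hNR, hNn, hNcol, hNfree, hNtop, hNmid⟩ := ladder_exact c M p hR' (by omega) (by omega) hfree
  have hNn' : N.E.ncard = p + d := by omega
  have hNcol0 : N.coloops = ∅ := by
    have h0 : N.coloops.ncard = 0 := by omega
    exact (Set.ncard_eq_zero (N.ground_finite.subset N.coloops_subset_ground)).1 h0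
  have hNd : N.E.encard = N.eRank + ((d - 1 + 1 : ℕ) : ℕ∞) := by
    rw [hNR, ← N.ground_finite.cast_ncard_eq, hNn', show d - 1 + 1 = d by omega]
    push_cast
    ring
  have hNd' : N.E.encard = N.eRank + (((d - 1 : ℕ) : ℕ∞) + 1) := by rw [hNd, Nat.cast_succ]
  have hNdd : N.E.encard = N.eRank + ((d : ℕ) : ℕ∞) := by rw [hNd, show d - 1 + 1 = d by omega]
  have hP' : {C : Set α | N.IsCircuit C ∧ C.ncard = 3}.ncard ≤ P :=
    (le_min (ncard_triangles_le_of_coloopFree N hNfree hNd hNcol0 hNn' (by omega))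
      (TriangleCap.core_ncard_triangles_le_cq3 N hNfree hNdd)).trans hP
  have hS' := hScap N hNfree hNdd hNn' hNcol0
  have hS5' := (ncard_fiveCircuits_le_of_coloopFree N hNfree hNd' hNcol0 hNn' (by omega)).trans hS5
  -- the core facts of `N`
  have hL : ∀ e ∈ N.E, ¬ N.IsLoop e := ThmN.not_isLoop_of_free N hNfree
  have hs : ∀ e ∈ N.E, ∀ f ∈ N.E, e ≠ f → N.eRk {e, f} = 2 := by
    intro e he f hf hef
    have h2 : (2 : ℕ∞) ≤ N.eRk {e, f} :=
      ThmN.two_le_eRk_of_two_le_ncard_of_free N hNfree (pair_subset he hf) (by rw [ncard_pair hef])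
    have h3 : N.eRk {e, f} ≤ 2 := by
      have := N.eRk_le_encard {e, f}
      rwa [encard_pair hef] at this
    exact le_antisymm h3 h2
  have hcirc : ∀ C, N.IsCircuit C → 3 ≤ C.encard := ThmN.three_le_encard_of_circuit N hL hs
  have hC1 : ∀ L ⊆ N.E, N.eRk L = 2 → L.ncard ≤ 3 := by
    intro L hL' hr
    have := ThmN.ncard_add_one_le_two_pow_of_eRk_le N hL hNfree 2 L hL' hr.le
    omega
  set t := {C : Set α | N.IsCircuit C ∧ C.ncard = 3}.ncard with ht
  set A := ∑ j ∈ Finset.range c, 2 ^ (n - 1 - j) with hA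
  set B := ∑ j ∈ Finset.range c, w3plus (n - 1 - j) with hB
  -- a kernel line applied to a triangle family `𝒯'` with union of size `u` and an exclusion `X`
  have hline : ∀ (𝒯' : Finset (Set α)), (∀ C ∈ 𝒯', N.IsCircuit C ∧ C.ncard = 3) → ∀ u, (⋃ C ∈ 𝒯', C).ncard = u →
      ∀ (Sn : Set α), Sn ⊆ N.E → ∀ (r kk X : ℕ), N.eRk Sn + (r : ℕ∞) ≤ (Sn.ncard : ℕ∞) → d + 1 ≤ kk + r →
      X ≤ {B : Set α | B ⊆ N.E ∧ B.ncard = 4 ∧ N.eRk B = 4 ∧ kk ≤ (B \ Sn).ncard}.ncard →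
      killnullOK (p + c) p d t S S5 (A + 𝒯'.card * (p + d - 3).choose (p - 3))
        (B + killPairB 𝒯'.card u (p + d) p) X = true →
      phiK (p + c) 4 * (Matroid.topCount N p 4 : ℚ) + B ≤ (Matroid.midCount N p 4 : ℚ) + A := by
    intro 𝒯' h𝒯' u hu Sn hSn r kk X hν hkk hX hok
    refine weighted_of_killnullOK_pairs N (p + c) p d t S S5 A B X hd4 hNR hNn' hNfree le_rfl hS' hS5' hp
      (by omega) 𝒯' h𝒯' hu hSn hν hkk hX ?_
    unfold killPairB at hok
    exact hok
  -- the weighted inequality on `N`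
  have hw : phiK (p + c) 4 * (Matroid.topCount N p 4 : ℚ) + B ≤ (Matroid.midCount N p 4 : ℚ) + A := by
    rcases Nat.eq_zero_or_pos t with h0 | hpos
    · exact weighted_of_ladderOK N (p + c) p d 0 S S5 A B hd4 hNR hNn' hNfree (by rw [← ht, h0]) hS' hS5'
        (by omega) (by omega) hzero
    · have htI : t ∈ Finset.Icc 1 P := Finset.mem_Icc.2 ⟨hpos, hP'⟩
      obtain ⟨hr1, hcq, hmono⟩ := hrr t htI
      set r := rr t with hr
      have hcq' : TriangleCap.cq3 (r - 1) < (ThmN.triangles N).ncard := hcq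
      obtain ⟨Sn, hSnE, 𝒯', h𝒯'tri, h𝒯'un, hu3r, hSnν, hcase⟩ := exists_chain_family N hNfree r hcq' hmono
      have hSnfin : Sn.Finite := N.ground_finite.subset hSnE
      have hsubS : ∀ C ∈ 𝒯', C ⊆ Sn := fun C hC => by
        rw [← h𝒯'un]; exact fun x hx => Set.mem_iUnion₂.2 ⟨C, hC, hx⟩
      -- `𝒯'` is nonempty (`Sn` has nullity `≥ r ≥ 1`), so `|Sn| ≥ 3`
      have hne : 𝒯'.Nonempty := by
        by_contra h0
        rw [Finset.not_nonempty_iff_eq_empty] at h0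
        rw [h0] at h𝒯'un
        simp only [Finset.notMem_empty, Set.iUnion_of_empty, Set.iUnion_empty] at h𝒯'un
        rw [← h𝒯'un, Set.ncard_empty, Matroid.eRk_empty, zero_add] at hSnν
        have : r ≤ 0 := by exact_mod_cast hSnν
        omega
      have hSn3 : 3 ≤ Sn.ncard := by
        obtain ⟨C, hC⟩ := hne
        have := Set.ncard_le_ncard (hsubS C hC) hSnfin
        rw [(h𝒯'tri C hC).2] at this
        exact this
      set u := Sn.ncard with hu
      set m := (N.E \ Sn).ncard with hm
      have hmE : m + u = N.E.ncard := Set.ncard_sdiff_add_ncard_of_subset hSnE N.ground_finite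
      have hmu : m = p + d - u := by omega
      have hu' : (⋃ C ∈ 𝒯', C).ncard = u := by rw [h𝒯'un]
      set k := d + 1 - r with hk
      -- the exclusion credit is honest, with `o` outside triangles
      have hXgen : ∀ o, o ≤ t → {C : Set α | N.IsCircuit C ∧ C.ncard = 3 ∧ ¬ C ⊆ Sn}.ncard ≤ o →
          exclXc (p + d) m k S t (t - o) ≤
            {B : Set α | B ⊆ N.E ∧ B.ncard = 4 ∧ N.eRk B = 4 ∧ k ≤ (B \ Sn).ncard}.ncard := by
        intro o hot ho
        unfold exclXc
        split_ifs with hk24 hm2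
        · obtain ⟨hm2', hk2'⟩ := hm2
          have h := excl_ge_two N hcirc hC1 (S := Sn) (by rw [← hm]; exact hm2')
          rw [hNn'] at h
          have hexcl : exclCount (p + d) 2 2 = (p + d - 2).choose 2 := by
            unfold exclCount
            rw [show (2 : ℕ).choose 4 = 0 from Nat.choose_eq_zero_of_lt (by norm_num)]
            simp
          rw [hexcl, hk2']
          have h2 : {C : Set α | N.IsCircuit C ∧ C.ncard = 3 ∧ ¬ C ⊆ Sn}.ncard ≤ t - (t - o) := by omega
          omega
        · have h := excl_ge_all N hcirc Sn hk24.1 hk24.2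
          rw [hNn', ← hm] at h
          unfold exclX
          have h2 : {C : Set α | N.IsCircuit C ∧ C.ncard = 3 ∧ ¬ C ⊆ Sn}.ncard * (p + d - 3) ≤
              (t - (t - o)) * (p + d - 3) := Nat.mul_le_mul_right _ (by omega)
          omega
        · exact Nat.zero_le _
      rcases hcase with ⟨h𝒯'r, hout⟩ | ⟨h𝒯'r, hall⟩
      · -- (A) the chain of `r` triangles
        have hout0 : {C : Set α | N.IsCircuit C ∧ C.ncard = 3 ∧ ¬ C ⊆ Sn}.ncard + r ≤ t := hout
        have hout' : {C : Set α | N.IsCircuit C ∧ C.ncard = 3 ∧ ¬ C ⊆ Sn}.ncard ≤ t - r := by omega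
        have hX := hXgen (t - r) (by omega) hout'
        have htr : t - (t - r) = r := by omega
        rw [htr] at hX
        have huI : u ∈ Finset.Icc 3 (3 * r) := Finset.mem_Icc.2 ⟨hSn3, by omega⟩
        refine hline 𝒯' h𝒯'tri u hu' Sn hSnE r k _ hSnν (by omega) hX ?_
        rw [h𝒯'r]
        have := hokA t htI u huI
        rwa [← hmu] at this
      · -- (B) every triangle inside `Sn`
        have hout0 : {C : Set α | N.IsCircuit C ∧ C.ncard = 3 ∧ ¬ C ⊆ Sn}.ncard ≤ 0 := by
          have hempty : {C : Set α | N.IsCircuit C ∧ C.ncard = 3 ∧ ¬ C ⊆ Sn} = ∅ := by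
            ext C
            simp only [Set.mem_setOf_eq, Set.mem_empty_iff_false, iff_false]
            rintro ⟨h1, h2, h3⟩
            exact h3 (hall C h1 h2)
          rw [hempty, Set.ncard_empty]
        have hX := hXgen 0 (Nat.zero_le _) hout0
        rw [Nat.sub_zero] at hX
        have hiI : 𝒯'.card ∈ Finset.Icc 1 (r - 1) := Finset.mem_Icc.2 ⟨Finset.card_pos.2 hne, by omega⟩
        have huI : u ∈ Finset.Icc 3 (3 * 𝒯'.card) := Finset.mem_Icc.2 ⟨hSn3, hu3r⟩
        refine hline 𝒯' h𝒯'tri u hu' Sn hSnE r k _ hSnν (by omega) hX ?_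
        have := hokB t htI 𝒯'.card hiI u huI
        rwa [← hmu] at this
  rw [ThmN.RLS_iff, hNtop]
  rw [hn] at hNmid
  have hmidQ : ((Matroid.midCount N p 4 : ℕ) : ℚ) + ((∑ j ∈ Finset.range c, 2 ^ (n - 1 - j) : ℕ) : ℚ) ≤
      ((Matroid.midCount M (p + c) 4 : ℕ) : ℚ) + ((∑ j ∈ Finset.range c, w3plus (n - 1 - j) : ℕ) : ℚ) := by
    exact_mod_cast hNmid
  linarith

end S1

end PercRepro
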